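import Literature.AlgebraicGeometry.Motives.HodgeThetaSubalgebraUnitaryEightTwentyOneCore
import HarnessLib

/-!
# Constant-rank Levi algebras do not exist: an irreducible unitary algebra of type `(3 | b)`, `b ≥ 5`, has a non-zero
# raising element of rank `≠ 2`, and one of type `(6 | b)`, `b ≥ 7`, has a non-zero raising element of rank `≠ 3`
# (Ribet 1983 Thm. 3, Lie step — the «inner double Levi» route, second level)

Family `hodge`, layer `Literature/AlgebraicGeometry/Motives` (pure linear algebra over `ℂ`; no geometry). Research
context: cell `pub-hodge-ring2` (HONEST FRAMING: research route conditional on HC_CM; not a corollary; Q11.4-sentence-2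
already refuted in dim ≥ 3), Literature lane gen 86, programme R73. UNCONDITIONAL; theorems only, no definition, no
named fact (D-0026), no `sorry`.

THE PRINT. K. A. Ribet, Amer. J. Math. 105 (1983), Thm. 3 = Gordon's survey Thm. 6.3 (3) [held
`paper:arxiv-alg-geom_9709030` p. 18]: `End⁰ = k` imaginary quadratic acting with coprime multiplicities `(n′, n″)` ⟹
`Hg = U(V, φ)`, hence `B•(Xⁿ) = D•(Xⁿ)`. Ribet's Lie step appeals to the classification of minuscule representations
(Serre); the lane replaces it pair by pair. After lit-g85 (R70–R72) every remaining prime cell `≤ 31` is an «`r = 6`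
stall», and the inner double Levi at a raising operator of maximal rank `6` leaves, in the cells `(8,15)`, `(9,14)`,
`(10,21)`, `(9,22)`, a CONCRETE Levi algebra all of whose non-zero raising elements have ONE AND THE SAME rank: type
`(6 | 9)` or `(6 | 15)` with constant raising rank `3`, type `(3 | 6)` with constant raising rank `2` (lit-g85 README
§«HEIRS — UPDATE AFTER R72»). This file proves that such algebras do not exist, classification-free.

SETTING (the unitary cores of the tree). `𝔊 ⊆ End(W)` bracket-closed and irreducible, `Θ ∈ 𝔊` an involution with
eigenspaces `P` (`+1`), `Q` (`−1`), Hermitian data `s` (additive, Hermitian-symmetric, `P ⊥ Q`, definite on `P` and on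
`Q`), `𝔊` adjoint-closed. A raising element is `A ∈ 𝔊` with `ΘA = A`, `AΘ = −A`.

* §1 Two general lemmas. **`UnitaryGenericRank.exists_finrank_le_finrank_range_add_smul`** — for linear `T₀, T` into a
  finite-dimensional space some `T + c·T₀` has rank `≥ rk T₀` (surjectivity onto `T₀`'s range is generic along the
  pencil: `UnitaryRaisingRank.exists_surjective_add_smul` after a projection onto `range T₀`);
  **`UnitaryLeviLift.exists_raise_restrict`** — an element `Z ∈ 𝔊` commuting with an involution `ι` (`ιΘ = Θι`) whose
  restriction to an `ι`-stable `U` is `Θ`-raising is, on `U`, the restriction of its raising component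
  `Z₊ = ¼(Z + ΘZ − ZΘ − ΘZΘ) ∈ 𝔊`, which is raising and commutes with `ι` (so the raising elements of a concrete Levi
  algebra `{Z|_U : Zι = ιZ}` are exactly the restrictions of the raising operators of `𝔊` commuting with `ι`).
* §2 **`UnitaryThree.exists_raise_rank_ne_two`** — type `(3 | b)`, `b ≥ 5`: some non-zero raising element has rank
  `≠ 2`. PROOF: otherwise every non-zero raising element has rank `2`; fix one, `B`, with its involution `ι`
  (`UnitaryLeviKernel.exists_involution`: `U⁺ = (P ∩ ker C) ⊕ C(P)` of type `(1 | 2)`, `U⁻ = B(W) ⊕ (Q ∩ ker B)` of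
  type `(2 | b − 2)`); a raising `X` commuting with `ι` and non-zero on `C(P)`
  (`UnitaryLeviFull.exists_raise_commute_apply_ne_zero`) has `rk X|_{U⁺} = 1`, hence `rk X|_{U⁻} = 1`
  (`UnitaryLeviRank.finrank_range_eq_add`): a rank-one raising element of the concrete Levi algebra `L⁻` (axioms by
  `UnitaryLeviFull.levi_axioms`), which is therefore full (`UnitaryRankOneRaise.eq_top_of_rankOne_raise_two`), and
  `UnitaryLeviFull.exists_rankOne_raise_of_full` produces a rank-one raising element of `𝔊` — contradiction.
* §3 **`UnitarySix.exists_raise_rank_ne_three`** — type `(6 | b)`, `b ≥ 7`: some non-zero raising element has rank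
  `≠ 3`. PROOF: otherwise fix a raising `B` (rank `3`, maximal) with involution `ι`: `U⁺` of type `(3 | 3)`, `U⁻` of
  type `(3 | b − 3)`. (i) No raising `X` commuting with `ι` has `rk X|_{U⁻} = 1` (that would be a rank-one raising
  element of `L⁻`, of type `(3 | b − 3)` with `b − 3 ≥ 4`, so `L⁻` would be full by
  `UnitaryRankOneRaise.eq_top_of_rankOne_raise` and `𝔊` would contain a rank-one raising element). (ii) `L⁺` is
  irreducible of type `(3 | 3)`, so it has a raising element of rank `≥ 2` (`UnitaryThreeCoprime.exists_raise_rank_ge_two`),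
  which lifts (§1) to a raising `X` commuting with `ι` with `rk X|_{U⁺} ≥ 2`; as `rk X = 3`, (i) forces
  `rk X|_{U⁺} = 3`, `X|_{U⁻} = 0`. (iii) `L⁻` likewise has a raising element of rank `≥ 2`, lifting to `X'` with
  `rk X'|_{U⁻} ≥ 2`, `rk X'|_{U⁺} ≤ 1`. Then `X + X'` is a raising element with `rk (X + X')|_{U⁻} = rk X'|_{U⁻} ≥ 2` and
  `rk (X + X')|_{U⁺} ≥ 3 − 1 = 2`, i.e. of rank `≥ 4` — contradiction.
By the classification these are the statements «`(3, b)` with constant raising rank `2`» and «`(6, b)` with constant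
raising rank `3`» have no model (the non-full models `𝔰𝔩₃ ⊗ 𝔥` on `ℂ³ ⊗ ℂᵈ`, `𝔰𝔩₅ ⊗ 𝔥` on `ℂ⁵ ⊗ ℂ³` have raising
ranks `{d}`, `{3, 6}`); here they are proved without it. CONSEQUENCES (sequels): the cores `(8 | 15)`, `(9 | 14)`
(`23 = 8 + 15 = 9 + 14`: every simple complex abelian `23`-fold with `End⁰ ≠ ℚ`), `(10 | 21)`, `(9 | 22)`, `(8 | 23)`.

## References
* [Ribet1983] K. A. Ribet, *Hodge classes on certain types of abelian varieties*, Amer. J. Math. 105 (1983), Thm. 3.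
* [Gordon1997] B. B. Gordon, *A survey of the Hodge conjecture for abelian varieties*, Thm. 6.3 (3), pp. 18–19.
* [Deligne1982HodgeCycles] P. Deligne, *Hodge cycles on abelian varieties*, LNM 900 (1982), I §3 Prop. 3.4, 3.6.
* [GoodmanWallachGTM255] R. Goodman, N. R. Wallach, GTM 255 (2009), §4.1.1.
* [Humphreys1972] J. E. Humphreys, *Introduction to Lie Algebras and Representation Theory*, §19.1.
* [HoffmanKunze1971LinearAlgebra] K. Hoffman, R. Kunze, *Linear Algebra* (1971), §3.1 Thm. 2, §6.2, §6.7.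
-/

noncomputable section

open Module

namespace Literature.AlgebraicGeometry.Motives

namespace HodgeStructure

universe u

variable {W : Type u} [AddCommGroup W] [Module ℂ W]

/-! ### §1 Generic rank along a pencil; lifting raising elements of a Levi algebra -/

/-- **Rank `≥ rk T₀` is generic along the pencil `T + c·T₀`.** For linear maps `T₀, T : E → F` (`F` finite-dimensional)
there is a scalar `c` with `rk (T + c·T₀) ≥ rk T₀`: compose with a projection `π` onto `range T₀`; `π ∘ T₀` is onto,
so some `π ∘ (T + c·T₀)` is onto (`UnitaryRaisingRank.exists_surjective_add_smul`).
[cite: HoffmanKunze1971LinearAlgebra, §6.2, §3.1 Thm. 2] -/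
theorem UnitaryGenericRank.exists_finrank_le_finrank_range_add_smul {E F : Type*} [AddCommGroup E] [Module ℂ E]
    [AddCommGroup F] [Module ℂ F] [FiniteDimensional ℂ F] (T₀ T : E →ₗ[ℂ] F) :
    ∃ c : ℂ, Module.finrank ℂ (LinearMap.range T₀) ≤ Module.finrank ℂ (LinearMap.range (T + c • T₀)) := by
  classical
  obtain ⟨π, hπ⟩ := LinearMap.exists_leftInverse_of_injective (LinearMap.range T₀).subtype
    (by rw [Submodule.ker_subtype])
  have hπid : ∀ y : LinearMap.range T₀, π (y : F) = y := fun y => by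
    have h := congrArg (fun f => f y) hπ
    simpa using h
  have hsurj : Function.Surjective (π ∘ₗ T₀) := fun y => by
    obtain ⟨x, hx⟩ := LinearMap.mem_range.1 y.2
    exact ⟨x, by rw [LinearMap.comp_apply, hx, hπid]⟩
  obtain ⟨c, hc⟩ := UnitaryRaisingRank.exists_surjective_add_smul (π ∘ₗ T₀) (π ∘ₗ T) hsurj
  refine ⟨c, ?_⟩
  have heq : π ∘ₗ T + c • (π ∘ₗ T₀) = π ∘ₗ (T + c • T₀) := by rw [LinearMap.comp_add, LinearMap.comp_smul]
  rw [heq] at hc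
  have hrange : LinearMap.range (π ∘ₗ (T + c • T₀)) = ⊤ := LinearMap.range_eq_top.2 hc
  calc Module.finrank ℂ (LinearMap.range T₀)
      = Module.finrank ℂ (⊤ : Submodule ℂ (LinearMap.range T₀)) := (finrank_top ℂ _).symm
    _ = Module.finrank ℂ (LinearMap.range (π ∘ₗ (T + c • T₀))) := by rw [hrange]
    _ ≤ Module.finrank ℂ (LinearMap.range (T + c • T₀)) := by
        rw [LinearMap.range_comp]; exact Submodule.finrank_map_le _ _

/-- For a subspace `U` and operators `X, Y`: `dim X(U) ≤ dim (X + Y)(U) + dim Y(U)` (`X u = (X + Y) u − Y u`).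
[cite: HoffmanKunze1971LinearAlgebra, §3.1 Thm. 2] -/
theorem UnitaryGenericRank.finrank_map_le_add [FiniteDimensional ℂ W] (U : Submodule ℂ W) (X Y : Module.End ℂ W) :
    Module.finrank ℂ (U.map X) ≤ Module.finrank ℂ (U.map (X + Y)) + Module.finrank ℂ (U.map Y) := by
  have hle : U.map X ≤ U.map (X + Y) ⊔ U.map Y := by
    rintro _ ⟨u, hu, rfl⟩
    have h : X u = (X + Y) u - Y u := by rw [LinearMap.add_apply]; abel
    rw [h]
    exact Submodule.sub_mem _ (Submodule.mem_sup_left (Submodule.mem_map_of_mem hu))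
      (Submodule.mem_sup_right (Submodule.mem_map_of_mem hu))
  have h := Submodule.finrank_sup_add_finrank_inf_eq (U.map (X + Y)) (U.map Y)
  have := Submodule.finrank_mono hle
  omega

/-- **Lifting raising elements of a Levi algebra.** Let `ι` commute with `Θ` (`Θ ∈ 𝔊` an involution) and `Z ∈ 𝔊`
commute with `ι`. If `Z` is `Θ`-raising ON a subspace `U` (`Θ Z u = Z u`, `Z Θ u = −Z u` for `u ∈ U`), then the raising
component `Z₊ = ¼(Z + ΘZ − ZΘ − ΘZΘ) ∈ 𝔊` — raising, commuting with `ι` — agrees with `Z` on `U`.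
[cite: GoodmanWallachGTM255, §4.1.1] [cite: Deligne1982HodgeCycles, I §3 Prop. 3.4] -/
theorem UnitaryLeviLift.exists_raise_restrict {𝔊 : Submodule ℂ (Module.End ℂ W)}
    (hbr : ∀ Y ∈ 𝔊, ∀ Z ∈ 𝔊, Y * Z - Z * Y ∈ 𝔊)
    {Θ : Module.End ℂ W} (hΘ : Θ ∈ 𝔊) (hΘΘ : Θ * Θ = 1)
    {ι : Module.End ℂ W} (hιΘ : ι * Θ = Θ * ι)
    {U : Submodule ℂ W} {Z : Module.End ℂ W} (hZ : Z ∈ 𝔊) (hZι : Z * ι = ι * Z)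
    (h1 : ∀ u ∈ U, Θ (Z u) = Z u) (h2 : ∀ u ∈ U, Z (Θ u) = -(Z u)) :
    ∃ X ∈ 𝔊, Θ * X = X ∧ X * Θ = -X ∧ X * ι = ι * X ∧ ∀ u ∈ U, X u = Z u := by
  have hΘΘv : ∀ v, Θ (Θ v) = v := fun v => by rw [← Module.End.mul_apply, hΘΘ, Module.End.one_apply]
  have hPhat : ∀ w, Θ ((2 : ℂ)⁻¹ • (w + Θ w)) = (2 : ℂ)⁻¹ • (w + Θ w) := fun w => by
    rw [map_smul, map_add, hΘΘv, add_comm]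
  have hsplitΘ : ∀ w, (2 : ℂ)⁻¹ • (w + Θ w) + (2 : ℂ)⁻¹ • (w - Θ w) = w := fun w => by module
  set X : Module.End ℂ W := (4 : ℂ)⁻¹ • (Z + Θ * Z - Z * Θ - Θ * Z * Θ) with hXdef
  have hXmem : X ∈ 𝔊 := UnitaryTheta.raise_mem hbr hΘ hΘΘv hZ
  have hΘX : Θ * X = X := LinearMap.ext fun v => UnitaryTheta.apply_raise_apply hΘΘv Z v
  have hXP : ∀ p, Θ p = p → X p = 0 := fun p hp => UnitaryTheta.raise_apply_of_eq Θ Z hp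
  have hXΘ : X * Θ = -X := by
    refine LinearMap.ext fun w => ?_
    rw [Module.End.mul_apply, LinearMap.neg_apply]
    have hΘw : Θ w = (2 : ℂ)⁻¹ • (w + Θ w) - (2 : ℂ)⁻¹ • (w - Θ w) := by module
    conv_lhs => rw [hΘw, map_sub, hXP _ (hPhat w), zero_sub]
    conv_rhs => rw [← hsplitΘ w, map_add, hXP _ (hPhat w), zero_add]
  have hXc : X * ι = ι * X := UnitaryLeviKernel.raise_commute hιΘ hZι
  refine ⟨X, hXmem, hΘX, hXΘ, hXc, fun u hu => ?_⟩
  rw [hXdef]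
  simp only [LinearMap.smul_apply, LinearMap.sub_apply, LinearMap.add_apply, Module.End.mul_apply, h2 u hu, map_neg,
    h1 u hu]
  module

/-! ### §2 Type `(3 | b)`, `b ≥ 5`: a non-zero raising element of rank `≠ 2` -/

/-- **An irreducible unitary algebra of type `(3 | b)`, `b ≥ 5`, has a non-zero raising element of rank `≠ 2`.**
See the module docstring, §2. [cite: Ribet1983, Thm. 3] [cite: Gordon1997, Thm. 6.3 (3)]
[cite: Deligne1982HodgeCycles, I §3 Prop. 3.4, 3.6] [cite: GoodmanWallachGTM255, §4.1.1] -/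
theorem UnitaryThree.exists_raise_rank_ne_two [FiniteDimensional ℂ W] {𝔊 : Submodule ℂ (Module.End ℂ W)}
    (hbr : ∀ Y ∈ 𝔊, ∀ Z ∈ 𝔊, Y * Z - Z * Y ∈ 𝔊)
    (hirr : ∀ U : Submodule ℂ W, (∀ A ∈ 𝔊, ∀ u ∈ U, A u ∈ U) → U = ⊥ ∨ U = ⊤)
    {Θ : Module.End ℂ W} (hΘ : Θ ∈ 𝔊) (hΘΘ : Θ * Θ = 1)
    {P Q : Submodule ℂ W} (hP : ∀ x, x ∈ P ↔ Θ x = x) (hQ : ∀ x, x ∈ Q ↔ Θ x = -x)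
    (hP3 : Module.finrank ℂ P = 3) (hQ5 : 5 ≤ Module.finrank ℂ Q)
    {s : W → W → ℂ} (hadd : ∀ x y z, s (x + y) z = s x z + s y z) (hsymm : ∀ x y, s y x = starRingEnd ℂ (s x y))
    (hPQ : ∀ p ∈ P, ∀ q ∈ Q, s p q = 0) (hdefP : ∀ p ∈ P, s p p = 0 → p = 0) (hdefQ : ∀ q ∈ Q, s q q = 0 → q = 0)
    (hadj : ∀ X ∈ 𝔊, ∃ Y ∈ 𝔊, ∀ x y, s (X x) y = s x (Y y)) :
    ∃ A ∈ 𝔊, Θ * A = A ∧ A * Θ = -A ∧ A ≠ 0 ∧ Module.finrank ℂ (LinearMap.range A) ≠ 2 := by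
  classical
  by_contra hne
  push Not at hne
  have hsU : ∀ U : Submodule ℂ W, ∀ x y z : U, s ((x + y : U) : W) z = s (x : W) z + s (y : W) z :=
    fun U x y z => by simp only [Submodule.coe_add, hadd]
  have hrk0 : ∀ B' : Module.End ℂ W, B' ≠ 0 → 0 < Module.finrank ℂ (LinearMap.range B') := fun B' hB'ne => by
    rw [Module.finrank_pos_iff_exists_ne_zero]
    by_contra h0
    push Not at h0
    apply hB'ne
    refine LinearMap.ext fun w => ?_
    have := h0 ⟨B' w, LinearMap.mem_range_self B' w⟩
    rw [LinearMap.zero_apply]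
    exact congrArg Subtype.val this
  -- a raising operator of rank two, of maximal rank; no raising operator of rank one
  obtain ⟨B, hB, hΘB, hBΘ, hr2⟩ :=
    UnitaryThreeCoprime.exists_raise_rank_ge_two hbr hirr hΘ hΘΘ hP hQ (by omega) (by omega)
  have hBne : B ≠ 0 := fun h => by rw [h, LinearMap.range_zero, finrank_bot] at hr2; omega
  have h2 : Module.finrank ℂ (LinearMap.range B) = 2 := hne B hB hΘB hBΘ hBne
  have hmax : ∀ B' ∈ 𝔊, Θ * B' = B' → B' * Θ = -B' →
      Module.finrank ℂ (LinearMap.range B') ≤ Module.finrank ℂ (LinearMap.range B) := by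
    intro B' hB' hΘB' hB'Θ
    by_cases hB'0 : B' = 0
    · rw [hB'0, LinearMap.range_zero, finrank_bot]; omega
    · rw [hne B' hB' hΘB' hB'Θ hB'0, h2]
  have hno1 : ∀ B' ∈ 𝔊, Θ * B' = B' → B' * Θ = -B' → Module.finrank ℂ (LinearMap.range B') ≠ 1 := by
    intro B' hB' hΘB' hB'Θ h1
    by_cases hB'0 : B' = 0
    · rw [hB'0, LinearMap.range_zero, finrank_bot] at h1; omega
    · rw [hne B' hB' hΘB' hB'Θ hB'0] at h1; omega
  -- the involution of `B`
  obtain ⟨C, hC, ι, hιmem, hBC, hΘC, hCΘ, hιι, hιΘ, hιs, hιa, hιd, hιb, hιc, hmemA, hmemD, hmemB, hmemC, hfinP₀, hfinQ₀,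
    hfinQU, hrangeP, hmapCQ, hfinUm, hfinUp⟩ :=
    UnitaryLeviKernel.exists_involution hbr hΘ hΘΘ hP hQ hadd hsymm hPQ hdefP hdefQ hadj hB hΘB hBΘ
  rw [h2, hP3] at hfinP₀
  rw [h2] at hfinQ₀ hfinQU
  rw [hP3] at hfinUp
  set Um : Submodule ℂ W := LinearMap.ker (ι + 1) with hUmdef
  set Up : Submodule ℂ W := LinearMap.ker (ι - 1) with hUpdef
  have hUm : ∀ x, x ∈ Um ↔ ι x = -x := fun x => by
    rw [hUmdef, LinearMap.mem_ker, LinearMap.add_apply, Module.End.one_apply, add_eq_zero_iff_eq_neg]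
  have hUp : ∀ x, x ∈ Up ↔ ι x = x := fun x => by
    rw [hUpdef, LinearMap.mem_ker, LinearMap.sub_apply, Module.End.one_apply, sub_eq_zero]
  have hcm : ∀ Z : Module.End ℂ W, Z * ι = ι * Z → ∀ x ∈ Um, Z x ∈ Um := fun Z hZ x hx =>
    (hUm _).2 (by rw [← Module.End.mul_apply, ← hZ, Module.End.mul_apply, (hUm x).1 hx, map_neg])
  have hcp : ∀ Z : Module.End ℂ W, Z * ι = ι * Z → ∀ x ∈ Up, Z x ∈ Up := fun Z hZ x hx =>
    (hUp _).2 (by rw [← Module.End.mul_apply, ← hZ, Module.End.mul_apply, (hUp x).1 hx])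
  obtain ⟨Im, Ip, Lm, Lp, -, -, hLm, hLp, -⟩ := UnitaryLeviKernel.exists_kernel_levi 𝔊 hιι hUm hUp
  -- a raising `X` commuting with `ι`, non-zero on `C(P)`: `rk X|_{U⁺} = rk X|_{U⁻} = 1`
  have hp0 : ∃ p, p ≠ 0 ∧ ι p = p ∧ Θ p = p := by
    obtain ⟨⟨p, hp⟩, hp0⟩ := Module.finrank_pos_iff_exists_ne_zero.1
      (show 0 < Module.finrank ℂ ↥(P ⊓ LinearMap.ker C) by omega)
    exact ⟨p, fun h => hp0 (Subtype.ext h), hιb p hp, (hP p).1 (Submodule.mem_inf.1 hp).1⟩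
  have hq0 : ∃ q, q ≠ 0 ∧ ι q = q ∧ Θ q = -q := by
    obtain ⟨⟨q, hq⟩, hq0⟩ := Module.finrank_pos_iff_exists_ne_zero.1
      (show 0 < Module.finrank ℂ ↥(P.map C) by omega)
    exact ⟨q, fun h => hq0 (Subtype.ext h), hιc q hq, (hQ q).1 (hmapCQ hq)⟩
  obtain ⟨X, hX, hΘX, hXΘ, hXc, c, hιc', hΘc, hXc0⟩ :=
    UnitaryLeviFull.exists_raise_commute_apply_ne_zero hbr hirr hΘ hΘΘ hQ hιmem hιι hιΘ hUm hUp hp0 hq0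
  have hXne : X ≠ 0 := fun h => hXc0 (by rw [h, LinearMap.zero_apply])
  have hX2 := hne X hX hΘX hXΘ hXne
  have hXsplit := UnitaryLeviRank.finrank_range_eq_add hιι hUm hUp hXc
  rw [hX2] at hXsplit
  have hXUp_le : Up.map X ≤ P ⊓ LinearMap.ker C := by
    rintro _ ⟨x, hx, rfl⟩
    exact hmemB _ ((hUp _).1 (hcp X hXc x hx)) (by rw [← Module.End.mul_apply, hΘX])
  have hXUp1 : Module.finrank ℂ (Up.map X) ≤ 1 := (Submodule.finrank_mono hXUp_le).trans (by omega)
  have hcUp : c ∈ Up := (hUp c).2 hιc'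
  have hXUp1' : 1 ≤ Module.finrank ℂ (Up.map X) := by
    rw [Nat.one_le_iff_ne_zero, Ne, Submodule.finrank_eq_zero]
    intro h0
    have : X c ∈ Up.map X := Submodule.mem_map_of_mem hcUp
    rw [h0, Submodule.mem_bot] at this
    exact hXc0 this
  have hXUm : Module.finrank ℂ (Um.map X) = 1 := by omega
  -- the concrete Levi algebra `L⁻` (type `(2 | b − 2)`) is full
  have hPUle : LinearMap.range B ≤ Um := fun x hx => (hUm x).2 (hιa x hx)
  have hQUle : Q ⊓ LinearMap.ker B ≤ Um := fun d hd => (hUm d).2 (hιd d hd)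
  have hPUmem : ∀ x ∈ Um, Θ x = x → x ∈ LinearMap.range B := fun x hx hΘx => hmemA x ((hUm x).1 hx) hΘx
  have hPUΘ : ∀ x ∈ LinearMap.range B, Θ x = x := fun x hx => (hP x).1 (hrangeP hx)
  have hQUmem : ∀ x ∈ Um, Θ x = -x → x ∈ Q ⊓ LinearMap.ker B := fun x hx hΘx => hmemD x ((hUm x).1 hx) hΘx
  have hQUΘ : ∀ x ∈ Q ⊓ LinearMap.ker B, Θ x = -x := fun x hx => (hQ x).1 (Submodule.mem_inf.1 hx).1
  have hPUQU : ∀ x ∈ LinearMap.range B, ∀ y ∈ Q ⊓ LinearMap.ker B, s x y = 0 := fun x hx y hy =>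
    hPQ x (hrangeP hx) y (Submodule.mem_inf.1 hy).1
  have hdefPU : ∀ x ∈ LinearMap.range B, s x x = 0 → x = 0 := fun x hx h => hdefP x (hrangeP hx) h
  have hdefQU : ∀ y ∈ Q ⊓ LinearMap.ker B, s y y = 0 → y = 0 := fun y hy h =>
    hdefQ y (Submodule.mem_inf.1 hy).1 h
  obtain ⟨ιm, Pm, Qm, hιmapply, hPmmem, hQmmem, hbrLm, hirrLm, hιmmem, hιmιm, hPm, hQm, hfinPm, hfinQm, hPmQm, hdefPm,
    hdefQm, hadjLm, -, -⟩ :=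
    UnitaryLeviFull.levi_axioms hbr hirr hΘΘ hP hQ hadd hsymm hPQ hdefP hdefQ hadj hιmem hιι hιs hΘ hΘΘ hιΘ hUm hPUle
      hQUle hPUmem hPUΘ hQUmem hQUΘ hPUQU hdefPU hdefQU hLm
  rw [h2] at hfinPm
  set x : Module.End ℂ Um := X.restrict (hcm X hXc) with hxdef
  have hxval : ∀ v : Um, ((x v : Um) : W) = X v := fun v => rfl
  have hxmem : x ∈ Lm := (hLm x).2 ⟨X, hX, hXc, hxval⟩
  have hιmx : ιm * x = x := LinearMap.ext fun v => Subtype.ext (by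
    rw [Module.End.mul_apply, hιmapply, hxval, ← Module.End.mul_apply, hΘX])
  have hxιm : x * ιm = -x := LinearMap.ext fun v => Subtype.ext (by
    rw [Module.End.mul_apply, LinearMap.neg_apply, Submodule.coe_neg, hxval, hιmapply, ← Module.End.mul_apply, hXΘ,
      LinearMap.neg_apply, hxval])
  have hxrk : Module.finrank ℂ (LinearMap.range x) = 1 := by
    rw [hxdef, UnitaryLeviRank.finrank_range_restrict, hXUm]
  have hLmtop : Lm = ⊤ :=
    UnitaryRankOneRaise.eq_top_of_rankOne_raise_two hbrLm hirrLm hιmmem hιmιm hPm hQm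
      (s := fun v w : Um => s (v : W) w) (hsU Um) (fun v w => hsymm v w) hPmQm hdefPm hdefQm hadjLm hxmem hιmx hxιm
      hxrk hfinPm (by rw [hfinQm]; omega)
  have hfullm : ∀ T : Module.End ℂ Um, ∃ Z ∈ 𝔊, Z * ι = ι * Z ∧ ∀ v : Um, ((T v : Um) : W) = Z v := fun T =>
    (hLm T).1 (by rw [hLmtop]; exact Submodule.mem_top)
  -- a rank-one raising operator: contradiction
  obtain ⟨⟨u, hu⟩, hu0⟩ := Module.finrank_pos_iff_exists_ne_zero.1
    (show 0 < Module.finrank ℂ (LinearMap.range B) by omega)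
  have hu0' : u ≠ 0 := fun h => hu0 (Subtype.ext h)
  obtain ⟨⟨q₀, hq₀⟩, hq₀0⟩ := Module.finrank_pos_iff_exists_ne_zero.1
    (show 0 < Module.finrank ℂ ↥(Q ⊓ LinearMap.ker B) by omega)
  have hq₀0' : q₀ ≠ 0 := fun h => hq₀0 (Subtype.ext h)
  obtain ⟨B₁, hB₁, hΘB₁, hB₁Θ, hr1⟩ := UnitaryLeviFull.exists_rankOne_raise_of_full hbr hΘΘ hιι hιΘ hUm hUp hfullm
    (by omega) (by omega) (hPUΘ u hu) (hιa u hu) hu0' (hQUΘ q₀ hq₀) (hιd q₀ hq₀) hq₀0'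
  exact hno1 B₁ hB₁ hΘB₁ hB₁Θ hr1

/-! ### §3 Type `(6 | b)`, `b ≥ 7`: a non-zero raising element of rank `≠ 3` -/

/-- **An irreducible unitary algebra of type `(6 | b)`, `b ≥ 7`, has a non-zero raising element of rank `≠ 3`.**
See the module docstring, §3. [cite: Ribet1983, Thm. 3] [cite: Gordon1997, Thm. 6.3 (3)]
[cite: Deligne1982HodgeCycles, I §3 Prop. 3.4, 3.6] [cite: GoodmanWallachGTM255, §4.1.1] [cite: Humphreys1972, §19.1] -/
theorem UnitarySix.exists_raise_rank_ne_three [FiniteDimensional ℂ W] {𝔊 : Submodule ℂ (Module.End ℂ W)}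
    (hbr : ∀ Y ∈ 𝔊, ∀ Z ∈ 𝔊, Y * Z - Z * Y ∈ 𝔊)
    (hirr : ∀ U : Submodule ℂ W, (∀ A ∈ 𝔊, ∀ u ∈ U, A u ∈ U) → U = ⊥ ∨ U = ⊤)
    {Θ : Module.End ℂ W} (hΘ : Θ ∈ 𝔊) (hΘΘ : Θ * Θ = 1)
    {P Q : Submodule ℂ W} (hP : ∀ x, x ∈ P ↔ Θ x = x) (hQ : ∀ x, x ∈ Q ↔ Θ x = -x)
    (hP6 : Module.finrank ℂ P = 6) (hQ7 : 7 ≤ Module.finrank ℂ Q)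
    {s : W → W → ℂ} (hadd : ∀ x y z, s (x + y) z = s x z + s y z) (hsymm : ∀ x y, s y x = starRingEnd ℂ (s x y))
    (hPQ : ∀ p ∈ P, ∀ q ∈ Q, s p q = 0) (hdefP : ∀ p ∈ P, s p p = 0 → p = 0) (hdefQ : ∀ q ∈ Q, s q q = 0 → q = 0)
    (hadj : ∀ X ∈ 𝔊, ∃ Y ∈ 𝔊, ∀ x y, s (X x) y = s x (Y y)) :
    ∃ A ∈ 𝔊, Θ * A = A ∧ A * Θ = -A ∧ A ≠ 0 ∧ Module.finrank ℂ (LinearMap.range A) ≠ 3 := by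
  classical
  by_contra hne
  push Not at hne
  obtain ⟨haddr, h0r, h0l, hnegr, hnegl, hsubr, hsubl⟩ := UnitaryTwoOdd.herm_right hadd hsymm
  have hsU : ∀ U : Submodule ℂ W, ∀ x y z : U, s ((x + y : U) : W) z = s (x : W) z + s (y : W) z :=
    fun U x y z => by simp only [Submodule.coe_add, hadd]
  have hrk : ∀ B' ∈ 𝔊, Θ * B' = B' → B' * Θ = -B' → Module.finrank ℂ (LinearMap.range B') ≤ 3 := by
    intro B' hB' hΘB' hB'Θ
    by_cases hB'0 : B' = 0
    · rw [hB'0, LinearMap.range_zero, finrank_bot]; omega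
    · rw [hne B' hB' hΘB' hB'Θ hB'0]
  -- a raising operator of rank three, of maximal rank; no raising operator of rank one
  obtain ⟨B, hB, hΘB, hBΘ, hr2⟩ :=
    UnitaryThreeCoprime.exists_raise_rank_ge_two hbr hirr hΘ hΘΘ hP hQ (by omega) (by omega)
  have hBne : B ≠ 0 := fun h => by rw [h, LinearMap.range_zero, finrank_bot] at hr2; omega
  have h3 : Module.finrank ℂ (LinearMap.range B) = 3 := hne B hB hΘB hBΘ hBne
  have hno1 : ∀ B' ∈ 𝔊, Θ * B' = B' → B' * Θ = -B' → Module.finrank ℂ (LinearMap.range B') ≠ 1 := by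
    intro B' hB' hΘB' hB'Θ h1
    by_cases hB'0 : B' = 0
    · rw [hB'0, LinearMap.range_zero, finrank_bot] at h1; omega
    · rw [hne B' hB' hΘB' hB'Θ hB'0] at h1; omega
  -- the involution of `B`: `U⁺` of type `(3 | 3)`, `U⁻` of type `(3 | b − 3)`
  obtain ⟨C, hC, ι, hιmem, hBC, hΘC, hCΘ, hιι, hιΘ, hιs, hιa, hιd, hιb, hιc, hmemA, hmemD, hmemB, hmemC, hfinP₀, hfinQ₀,
    hfinQU, hrangeP, hmapCQ, hfinUm, hfinUp⟩ :=
    UnitaryLeviKernel.exists_involution hbr hΘ hΘΘ hP hQ hadd hsymm hPQ hdefP hdefQ hadj hB hΘB hBΘ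
  rw [h3, hP6] at hfinP₀
  rw [h3] at hfinQ₀ hfinQU
  rw [hP6] at hfinUp
  have hP₀3 : Module.finrank ℂ ↥(P ⊓ LinearMap.ker C) = 3 := by omega
  set Um : Submodule ℂ W := LinearMap.ker (ι + 1) with hUmdef
  set Up : Submodule ℂ W := LinearMap.ker (ι - 1) with hUpdef
  have hUm : ∀ x, x ∈ Um ↔ ι x = -x := fun x => by
    rw [hUmdef, LinearMap.mem_ker, LinearMap.add_apply, Module.End.one_apply, add_eq_zero_iff_eq_neg]
  have hUp : ∀ x, x ∈ Up ↔ ι x = x := fun x => by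
    rw [hUpdef, LinearMap.mem_ker, LinearMap.sub_apply, Module.End.one_apply, sub_eq_zero]
  have hcm : ∀ Z : Module.End ℂ W, Z * ι = ι * Z → ∀ x ∈ Um, Z x ∈ Um := fun Z hZ x hx =>
    (hUm _).2 (by rw [← Module.End.mul_apply, ← hZ, Module.End.mul_apply, (hUm x).1 hx, map_neg])
  have hcp : ∀ Z : Module.End ℂ W, Z * ι = ι * Z → ∀ x ∈ Up, Z x ∈ Up := fun Z hZ x hx =>
    (hUp _).2 (by rw [← Module.End.mul_apply, ← hZ, Module.End.mul_apply, (hUp x).1 hx])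
  obtain ⟨Im, Ip, Lm, Lp, -, -, hLm, hLp, -⟩ := UnitaryLeviKernel.exists_kernel_levi 𝔊 hιι hUm hUp
  -- rank bookkeeping for raising operators commuting with `ι`
  have hsplit : ∀ X ∈ 𝔊, Θ * X = X → X * Θ = -X → X * ι = ι * X →
      Module.finrank ℂ (Up.map X) + Module.finrank ℂ (Um.map X) ≤ 3 ∧
        (X ≠ 0 → Module.finrank ℂ (Up.map X) + Module.finrank ℂ (Um.map X) = 3) := by
    intro X hX hΘX hXΘ hXc
    have h := UnitaryLeviRank.finrank_range_eq_add hιι hUm hUp hXc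
    refine ⟨by rw [← h]; exact hrk X hX hΘX hXΘ, fun hX0 => by rw [← h]; exact hne X hX hΘX hXΘ hX0⟩
  -- the concrete Levi algebra `L⁻` (type `(3 | b − 3)`)
  have hPUle : LinearMap.range B ≤ Um := fun x hx => (hUm x).2 (hιa x hx)
  have hQUle : Q ⊓ LinearMap.ker B ≤ Um := fun d hd => (hUm d).2 (hιd d hd)
  have hPUmem : ∀ x ∈ Um, Θ x = x → x ∈ LinearMap.range B := fun x hx hΘx => hmemA x ((hUm x).1 hx) hΘx
  have hPUΘ : ∀ x ∈ LinearMap.range B, Θ x = x := fun x hx => (hP x).1 (hrangeP hx)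
  have hQUmem : ∀ x ∈ Um, Θ x = -x → x ∈ Q ⊓ LinearMap.ker B := fun x hx hΘx => hmemD x ((hUm x).1 hx) hΘx
  have hQUΘ : ∀ x ∈ Q ⊓ LinearMap.ker B, Θ x = -x := fun x hx => (hQ x).1 (Submodule.mem_inf.1 hx).1
  have hPUQU : ∀ x ∈ LinearMap.range B, ∀ y ∈ Q ⊓ LinearMap.ker B, s x y = 0 := fun x hx y hy =>
    hPQ x (hrangeP hx) y (Submodule.mem_inf.1 hy).1
  have hdefPU : ∀ x ∈ LinearMap.range B, s x x = 0 → x = 0 := fun x hx h => hdefP x (hrangeP hx) h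
  have hdefQU : ∀ y ∈ Q ⊓ LinearMap.ker B, s y y = 0 → y = 0 := fun y hy h =>
    hdefQ y (Submodule.mem_inf.1 hy).1 h
  obtain ⟨ιm, Pm, Qm, hιmapply, hPmmem, hQmmem, hbrLm, hirrLm, hιmmem, hιmιm, hPm, hQm, hfinPm, hfinQm, hPmQm, hdefPm,
    hdefQm, hadjLm, -, -⟩ :=
    UnitaryLeviFull.levi_axioms hbr hirr hΘΘ hP hQ hadd hsymm hPQ hdefP hdefQ hadj hιmem hιι hιs hΘ hΘΘ hιΘ hUm hPUle
      hQUle hPUmem hPUΘ hQUmem hQUΘ hPUQU hdefPU hdefQU hLm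
  rw [h3] at hfinPm
  -- the concrete Levi algebra `L⁺` (involution `−ι`; type `(3 | 3)`)
  have hnι : -ι ∈ 𝔊 := Submodule.neg_mem _ hιmem
  have hnιι : (-ι) * (-ι) = 1 := by rw [neg_mul_neg, hιι]
  have hnιs : ∀ v w, s ((-ι) v) w = s v ((-ι) w) := fun v w => by
    rw [LinearMap.neg_apply, LinearMap.neg_apply, hnegl, hnegr, hιs]
  have hnιΘ : (-ι) * Θ = Θ * (-ι) := by rw [neg_mul, mul_neg, hιΘ]
  have hUp' : ∀ v, v ∈ Up ↔ (-ι) v = -v := fun v => by rw [hUp, LinearMap.neg_apply, neg_inj]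
  have hPUle' : P ⊓ LinearMap.ker C ≤ Up := fun v hv => (hUp v).2 (hιb v hv)
  have hQUle' : P.map C ≤ Up := fun v hv => (hUp v).2 (hιc v hv)
  have hPUmem' : ∀ v ∈ Up, Θ v = v → v ∈ P ⊓ LinearMap.ker C := fun v hv hΘv => hmemB v ((hUp v).1 hv) hΘv
  have hPUΘ' : ∀ v ∈ P ⊓ LinearMap.ker C, Θ v = v := fun v hv => (hP v).1 (Submodule.mem_inf.1 hv).1
  have hQUmem' : ∀ v ∈ Up, Θ v = -v → v ∈ P.map C := fun v hv hΘv => hmemC v ((hUp v).1 hv) hΘv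
  have hQUΘ' : ∀ v ∈ P.map C, Θ v = -v := fun v hv => (hQ v).1 (hmapCQ hv)
  have hPUQU' : ∀ v ∈ P ⊓ LinearMap.ker C, ∀ w ∈ P.map C, s v w = 0 := fun v hv w hw =>
    hPQ v (Submodule.mem_inf.1 hv).1 w (hmapCQ hw)
  have hdefPU' : ∀ v ∈ P ⊓ LinearMap.ker C, s v v = 0 → v = 0 := fun v hv h =>
    hdefP v (Submodule.mem_inf.1 hv).1 h
  have hdefQU' : ∀ w ∈ P.map C, s w w = 0 → w = 0 := fun w hw h => hdefQ w (hmapCQ hw) h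
  have hLp' : ∀ A, A ∈ Lp ↔ ∃ Z ∈ 𝔊, Z * (-ι) = (-ι) * Z ∧ ∀ v : Up, ((A v : Up) : W) = Z v := fun A => by
    rw [hLp]
    constructor
    · rintro ⟨Z, hZ, hZc, hZv⟩; exact ⟨Z, hZ, by rw [mul_neg, neg_mul, hZc], hZv⟩
    · rintro ⟨Z, hZ, hZc, hZv⟩; exact ⟨Z, hZ, by rw [mul_neg, neg_mul, neg_inj] at hZc; exact hZc, hZv⟩
  obtain ⟨ιp, Pp, Qp, hιpapply, hPpmem, hQpmem, hbrLp, hirrLp, hιpmem, hιpιp, hPp, hQp, hfinPp, hfinQp, hPpQp, hdefPp,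
    hdefQp, hadjLp, -, -⟩ :=
    UnitaryLeviFull.levi_axioms hbr hirr hΘΘ hP hQ hadd hsymm hPQ hdefP hdefQ hadj hnι hnιι hnιs hΘ hΘΘ hnιΘ hUp'
      hPUle' hQUle' hPUmem' hPUΘ' hQUmem' hQUΘ' hPUQU' hdefPU' hdefQU' hLp'
  rw [hP₀3] at hfinPp
  rw [hfinQU] at hfinQp
  -- (i) no raising operator commuting with `ι` has `rk X|_{U⁻} = 1`
  have hkill : ∀ X ∈ 𝔊, Θ * X = X → X * Θ = -X → X * ι = ι * X → Module.finrank ℂ (Um.map X) ≠ 1 := by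
    intro X hX hΘX hXΘ hXc hXUm
    set x : Module.End ℂ Um := X.restrict (hcm X hXc) with hxdef
    have hxval : ∀ v : Um, ((x v : Um) : W) = X v := fun v => rfl
    have hxmem : x ∈ Lm := (hLm x).2 ⟨X, hX, hXc, hxval⟩
    have hιmx : ιm * x = x := LinearMap.ext fun v => Subtype.ext (by
      rw [Module.End.mul_apply, hιmapply, hxval, ← Module.End.mul_apply, hΘX])
    have hxιm : x * ιm = -x := LinearMap.ext fun v => Subtype.ext (by
      rw [Module.End.mul_apply, LinearMap.neg_apply, Submodule.coe_neg, hxval, hιmapply, ← Module.End.mul_apply, hXΘ,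
        LinearMap.neg_apply, hxval])
    have hxrk : Module.finrank ℂ (LinearMap.range x) = 1 := by
      rw [hxdef, UnitaryLeviRank.finrank_range_restrict, hXUm]
    have hLmtop : Lm = ⊤ :=
      UnitaryRankOneRaise.eq_top_of_rankOne_raise hbrLm hirrLm hιmmem hιmιm hPm hQm
        (s := fun v w : Um => s (v : W) w) (hsU Um) (fun v w => hsymm v w) hPmQm hdefPm hdefQm hadjLm hxmem hιmx hxιm
        hxrk (by rw [hfinPm, hfinQm]; omega) (by rw [hfinPm]) (by rw [hfinQm]; omega)
    have hfullm : ∀ T : Module.End ℂ Um, ∃ Z ∈ 𝔊, Z * ι = ι * Z ∧ ∀ v : Um, ((T v : Um) : W) = Z v := fun T =>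
      (hLm T).1 (by rw [hLmtop]; exact Submodule.mem_top)
    obtain ⟨⟨u, hu⟩, hu0⟩ := Module.finrank_pos_iff_exists_ne_zero.1
      (show 0 < Module.finrank ℂ (LinearMap.range B) by omega)
    have hu0' : u ≠ 0 := fun h => hu0 (Subtype.ext h)
    obtain ⟨⟨q₀, hq₀⟩, hq₀0⟩ := Module.finrank_pos_iff_exists_ne_zero.1
      (show 0 < Module.finrank ℂ ↥(Q ⊓ LinearMap.ker B) by omega)
    have hq₀0' : q₀ ≠ 0 := fun h => hq₀0 (Subtype.ext h)
    obtain ⟨B₁, hB₁, hΘB₁, hB₁Θ, hr1⟩ := UnitaryLeviFull.exists_rankOne_raise_of_full hbr hΘΘ hιι hιΘ hUm hUp hfullm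
      (by omega) (by omega) (hPUΘ u hu) (hιa u hu) hu0' (hQUΘ q₀ hq₀) (hιd q₀ hq₀) hq₀0'
    exact hno1 B₁ hB₁ hΘB₁ hB₁Θ hr1
  -- (ii) a raising element of `L⁺` of rank `≥ 2` lifts to `X` with `rk X|_{U⁺} = 3`, `X|_{U⁻} = 0`
  obtain ⟨T, hT, hιpT, hTιp, hT2⟩ :=
    UnitaryThreeCoprime.exists_raise_rank_ge_two hbrLp hirrLp hιpmem hιpιp hPp hQp (by omega) (by omega)
  obtain ⟨Z, hZ, hZc, hTZ⟩ := (hLp T).1 hT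
  have hZ1 : ∀ u ∈ Up, Θ (Z u) = Z u := fun u hu => by
    have h := congrArg (fun A => ((A ⟨u, hu⟩ : Up) : W)) hιpT
    simp only [Module.End.mul_apply, hιpapply, hTZ] at h
    exact h
  have hZ2 : ∀ u ∈ Up, Z (Θ u) = -(Z u) := fun u hu => by
    have h := congrArg (fun A => ((A ⟨u, hu⟩ : Up) : W)) hTιp
    simp only [Module.End.mul_apply, LinearMap.neg_apply, Submodule.coe_neg, hTZ] at h
    rw [hιpapply] at h
    exact h
  obtain ⟨X, hX, hΘX, hXΘ, hXc, hXZ⟩ := UnitaryLeviLift.exists_raise_restrict hbr hΘ hΘΘ hιΘ hZ hZc hZ1 hZ2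
  have hxT : X.restrict (hcp X hXc) = T := LinearMap.ext fun v => Subtype.ext (by
    rw [LinearMap.coe_restrict_apply, hXZ v v.2, hTZ v])
  have hXUp : 2 ≤ Module.finrank ℂ (Up.map X) := by
    rw [← UnitaryLeviRank.finrank_range_restrict (hcp X hXc), hxT]; exact hT2
  have hXne : X ≠ 0 := by
    intro h
    rw [h, Submodule.map_zero, finrank_bot] at hXUp
    omega
  obtain ⟨-, hX3⟩ := hsplit X hX hΘX hXΘ hXc
  have hX3 := hX3 hXne
  have hXUm0 : Module.finrank ℂ (Um.map X) = 0 := by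
    have hk := hkill X hX hΘX hXΘ hXc
    omega
  have hXUp3 : Module.finrank ℂ (Up.map X) = 3 := by omega
  have hXm : ∀ v ∈ Um, X v = 0 := fun v hv => by
    have h0 : Um.map X = ⊥ := Submodule.finrank_eq_zero.1 hXUm0
    have : X v ∈ Um.map X := Submodule.mem_map_of_mem hv
    rwa [h0, Submodule.mem_bot] at this
  -- (iii) a raising element of `L⁻` of rank `≥ 2` lifts to `X'` with `rk X'|_{U⁻} ≥ 2`, `rk X'|_{U⁺} ≤ 1`
  obtain ⟨T', hT', hιmT', hT'ιm, hT'2⟩ :=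
    UnitaryThreeCoprime.exists_raise_rank_ge_two hbrLm hirrLm hιmmem hιmιm hPm hQm (by omega) (by omega)
  obtain ⟨Z', hZ', hZ'c, hT'Z'⟩ := (hLm T').1 hT'
  have hZ'1 : ∀ u ∈ Um, Θ (Z' u) = Z' u := fun u hu => by
    have h := congrArg (fun A => ((A ⟨u, hu⟩ : Um) : W)) hιmT'
    simp only [Module.End.mul_apply, hιmapply, hT'Z'] at h
    exact h
  have hZ'2 : ∀ u ∈ Um, Z' (Θ u) = -(Z' u) := fun u hu => by
    have h := congrArg (fun A => ((A ⟨u, hu⟩ : Um) : W)) hT'ιm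
    simp only [Module.End.mul_apply, LinearMap.neg_apply, Submodule.coe_neg, hT'Z'] at h
    rw [hιmapply] at h
    exact h
  obtain ⟨X', hX', hΘX', hX'Θ, hX'c, hX'Z'⟩ := UnitaryLeviLift.exists_raise_restrict hbr hΘ hΘΘ hιΘ hZ' hZ'c hZ'1 hZ'2
  have hx'T' : X'.restrict (hcm X' hX'c) = T' := LinearMap.ext fun v => Subtype.ext (by
    rw [LinearMap.coe_restrict_apply, hX'Z' v v.2, hT'Z' v])
  have hX'Um : 2 ≤ Module.finrank ℂ (Um.map X') := by
    rw [← UnitaryLeviRank.finrank_range_restrict (hcm X' hX'c), hx'T']; exact hT'2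
  obtain ⟨hX'le, -⟩ := hsplit X' hX' hΘX' hX'Θ hX'c
  have hX'Up : Module.finrank ℂ (Up.map X') ≤ 1 := by omega
  -- (iv) `X + X'` has rank `≥ 4`
  set Y : Module.End ℂ W := X + X' with hYdef
  have hY : Y ∈ 𝔊 := Submodule.add_mem _ hX hX'
  have hΘY : Θ * Y = Y := by rw [hYdef, mul_add, hΘX, hΘX']
  have hYΘ : Y * Θ = -Y := by rw [hYdef, add_mul, hXΘ, hX'Θ, neg_add]
  have hYc : Y * ι = ι * Y := by rw [hYdef, add_mul, mul_add, hXc, hX'c]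
  have hYUm : 2 ≤ Module.finrank ℂ (Um.map Y) := by
    refine hX'Um.trans (Submodule.finrank_mono ?_)
    rintro _ ⟨v, hv, rfl⟩
    refine ⟨v, hv, ?_⟩
    rw [hYdef, LinearMap.add_apply, hXm v hv, zero_add]
  have hYUp : 2 ≤ Module.finrank ℂ (Up.map Y) := by
    have h := UnitaryGenericRank.finrank_map_le_add Up X X'
    rw [← hYdef] at h
    omega
  obtain ⟨hYle, -⟩ := hsplit Y hY hΘY hYΘ hYc
  omega

end HodgeStructure

end Literature.AlgebraicGeometry.Motives
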